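import Summits.HodgeConjecture.HodgeConjecture.Theorems.F0P3GlobalPacket                    -- ★ (N) FILE 2 p840909: `GlobalPacket 𝔩`, `IsDiscrete`, `nRecip`, `trAt` (+ ★ FILE 1 `LocalPacketKit`)
import Summits.HodgeConjecture.HodgeConjecture.Theorems.F0P3ArchPacketKit                   -- ★ (N) FILE 1b p841091: `ArchPacketKit`, `trPktInf`, `ContainsAPacketInf`
import Summits.HodgeConjecture.HodgeConjecture.Theorems.F0P3SemilocalTestFunctionsOfRecord  -- ★ `TestS₀ L H ι T hT S` (fields `arch`, `loc`)
import HarnessLib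

/-!
# (N) DEFS, FILE 3a — THE `G`-SIDE SPECTRAL PACKET `SpectralPacketG 𝔩 𝔞 μ` (finite-place packet + archimedean packet, DISCRETE) and its tuple coordinates `n`, `trS`

Cell `hodgecm-mathlib`, F0∕P3 «U3-mult», crux H413 (`stmt-HodgeConjecture-24833`); FILE 3 census `CENSUS-N-FILE3-SpectralTuple…md` c70774ab (T1 rows #1 #3 #13, T5) of the
(N) DEFS plan «=»'d by LEAD F0P3a-plan (g9) T8-23 (A) ∕ T8-48 (B) (F0P3a-p01 (g11), (N) lead pen, 2026-09-01).  DEF LANE: ONE structure + three definitions + `rfl`∕easy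
read-backs; no law, no instance, no notation, no named fact, no `sorry`.  ASSERTS NOTHING.

WHAT.  The `G`-side carrier `PG` of the spectral letter `K9SpectralLetter` (closer `Cruxes/H413/Lines/F0_U3LettersRung1.lean` ED. 19b) as a DEFINED type over the posited kits:
a DISCRETE global packet = a finite-place packet `fin : GlobalPacket 𝔩` [Rogawski1990 §13.3 p. 203 ¶2] paired with an archimedean packet `inf : 𝔞.PktInf` [§12.3] (census T5:
(T) and `trGS` read `Tr Π_∞(f_∞)` for EVERY packet), with `fin.IsDiscrete μ` («some member occurs in the discrete spectrum», p. 199; ★ F0P2-p01 `cmOccursInDiscreteSpectrum`).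
Coordinates: `n Q := Card(Π̂)⁻¹` [Thm 13.3.7] (★ FILE 2 `nRecip`, relative to the «discrete `H`-packet» predicate `DiscH` — the `H`-side automorphic measure is the typer's q2);
the `S`-SEMILOCAL PACKET TRACE on the T1∕K0 test datum ★ `TestS₀` [§14.2 p. 233 «`f′_{S,∞} = f′_∞ ⊗ ⊗_{v∈S} f′_v`»; §13.3 p. 203 «`Tr Π(f) = ∏_v Tr Π_v(f_v)`»]:
`trS Q S νG archTr fS := Tr Π_∞(fS.arch) · ∏_{v ∈ S} Tr Π_v(fS.loc v)` = ★ `trPktInf` × ★ `trPkt` — the tuple's `trGS` (census T1 #13).  NOT here (census T1∕T3): `trG` on all of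
`TestG L` (★ ROAD «TF» at packet members), `PiXi` (needs the letter «`Π(ξ)` is discrete», Thm 13.3.6 (b)), the `H`-side (`μH`, transfer of test functions), `evpG`∕`ramG`
(FILE 2b riders, F0P2-p01 (g9), T8-66 (B)).
HC_CM is proved only modulo the printed citations until rung 0 closes.
-/

set_option autoImplicit false
set_option linter.dupNamespace false

noncomputable section

open NumberField IsDedekindDomain MeasureTheory
open scoped Matrix MatrixGroups

namespace Summit.HodgeConjecture.HodgeConjecture.Cruxes.H413.F0P3SpectralPacket

open Literature.NumberTheory Literature.NumberTheory.Automorphic Literature.NumberTheory.Automorphic.UnitaryGroup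
open Literature.NumberTheory.Rogawski1990 Literature.NumberTheory.GaloisRepresentations
open Literature.RepresentationTheory.BorelWallach2000 Literature.RepresentationTheory.KonnoKonno2007
open Summit.HodgeConjecture.HodgeConjecture.Cruxes.H413.F0P3LocalPacketKit
open Summit.HodgeConjecture.HodgeConjecture.Cruxes.H413.F0P3GlobalPacket
open Summit.HodgeConjecture.HodgeConjecture.Cruxes.H413.F0P3ArchPacketKit
open Summit.HodgeConjecture.HodgeConjecture.Cruxes.H413.F0P3SemilocalTestFunctionsOfRecord (TestS₀)

variable {L : Type} [Field L] [NumberField L] [IsCMField L] {H : Matrix (Fin 3) (Fin 3) L}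

/-! ## §1 The discrete `G`-side packet with its archimedean component [p. 201 ¶2; §12.3; Thm 13.3.8 «packets with central character `ω`»] -/

/-- **`SpectralPacketG 𝔩 𝔞 μ` — A DISCRETE GLOBAL PACKET OF `G` WITH ITS ARCHIMEDEAN COMPONENT**: `fin` a finite-place packet over the kit family `𝔩`
[p. 201 ¶2], `inf` an archimedean packet of the kit `𝔞` [§12.3], and `isDiscrete : fin.IsDiscrete μ` («discrete if some member occurs in the discrete spectrum»,
p. 199; the central character `ω` of Thm 13.3.8 is fixed by the automorphic measure `μ`'s quotient).  The type `PG` of the spectral letter's tuple.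
[cite: Rogawski1990, §13.3 p. 203 ¶2, Thm. 13.3.8 p. 203; §12.3 p. 178] -/
structure SpectralPacketG (𝔩 : ∀ v : HeightOneSpectrum (𝓞 ↥(maximalRealSubfield L)), LocalPacketKit L H v) (𝔞 : ArchPacketKit)
    (μ : Measure (adelicGroupData (↥(maximalRealSubfield L)) L (IsCMField.complexConj L) 3 H).automorphicQuotient)
    [SMulInvariantMeasure (adelicGroupData (↥(maximalRealSubfield L)) L (IsCMField.complexConj L) 3 H).Adelic
      (adelicGroupData (↥(maximalRealSubfield L)) L (IsCMField.complexConj L) 3 H).automorphicQuotient μ] : Type where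
  /-- the finite-place packet `⊗_{v < ∞} Π_v`. -/
  fin : GlobalPacket 𝔩
  /-- the archimedean packet `Π_∞`. -/
  inf : 𝔞.PktInf
  /-- «some member of `Π` occurs in the discrete spectrum». -/
  isDiscrete : fin.IsDiscrete μ

namespace SpectralPacketG

variable {𝔩 : ∀ v : HeightOneSpectrum (𝓞 ↥(maximalRealSubfield L)), LocalPacketKit L H v} {𝔞 : ArchPacketKit}
  {μ : Measure (adelicGroupData (↥(maximalRealSubfield L)) L (IsCMField.complexConj L) 3 H).automorphicQuotient}
  [SMulInvariantMeasure (adelicGroupData (↥(maximalRealSubfield L)) L (IsCMField.complexConj L) 3 H).Adelic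
    (adelicGroupData (↥(maximalRealSubfield L)) L (IsCMField.complexConj L) 3 H).automorphicQuotient μ]

/-! ## §2 Tuple coordinates: `n(Π)` and the `S`-semilocal packet trace `Tr Π_{S,∞}(f′_{S,∞})` [Thm 13.3.7; p. 203; §14.2 p. 233] -/

/-- **`n(Π) = Card(Π̂)⁻¹`** as a complex number (the tuple's `nG`), relative to the «discrete `H`-packet» predicate `DiscH` (★ FILE 2 `nRecip`).
[cite: Rogawski1990, §13.3 Thm. 13.3.7 pp. 202–203] -/
def n (Q : SpectralPacketG 𝔩 𝔞 μ) (DiscH : GlobalPacketH 𝔩 → Prop) : ℂ :=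
  ((Q.fin.nRecip DiscH : ℚ) : ℂ)

/-- **The `S`-semilocal packet trace `Tr Π_{S,∞}(f′_{S,∞}) := Tr Π_∞(f′_∞) · ∏_{v ∈ S} Tr Π_v(f′_v)`** on the test datum ★ `TestS₀ S` (`arch`, `loc`), for the local measures
`νG` and an archimedean distribution character `archTr` (the closer's ★ `archTr₀ …`) — the tuple's `trGS S` [p. 203 «`Tr Π(f) = ∏_v Tr Π_v(f_v)`», restricted to the
`S ∪ ∞` factors; §14.2 p. 233]. [cite: Rogawski1990, §13.3 p. 203; §14.2 p. 233] -/
def trS (Q : SpectralPacketG 𝔩 𝔞 μ) {ι : L →+* ℂ} {T : GL (Fin 3) ℂ}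
    {hT : (T : Matrix (Fin 3) (Fin 3) ℂ)ᴴ * H.map ι * (T : Matrix (Fin 3) (Fin 3) ℂ) = Literature.Geometry.ComplexHyperbolic.BallModel.J}
    (S : Finset (HeightOneSpectrum (𝓞 ↥(maximalRealSubfield L))))
    [∀ v : HeightOneSpectrum (𝓞 ↥(maximalRealSubfield L)), MeasurableSpace ((cmDatum L 3 H).Local v)]
    (νG : ∀ v : HeightOneSpectrum (𝓞 ↥(maximalRealSubfield L)), Measure ((cmDatum L 3 H).Local v))
    (archTr : GKIrrClass (uFormGroup (Fin 2) (Fin 1)) → (UnitaryGroup.arch (↥(maximalRealSubfield L)) L (IsCMField.complexConj L) 3 H → ℂ) → ℂ)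
    (fS : TestS₀ L H ι T hT S) : ℂ :=
  𝔞.trPktInf archTr Q.inf fS.arch * ∏ v : ↥S, (𝔩 v.1).trPkt (νG v.1) (Q.fin.loc v.1) (fS.loc v)

/-- **The local factor at `v`** (★ FILE 2 `trAt`). [cite: Rogawski1990, §13.3 p. 203] -/
def trAt (Q : SpectralPacketG 𝔩 𝔞 μ) (v : HeightOneSpectrum (𝓞 ↥(maximalRealSubfield L)))
    [MeasurableSpace ((cmDatum L 3 H).Local v)] (νG : Measure ((cmDatum L 3 H).Local v)) (f : (cmDatum L 3 H).Local v → ℂ) : ℂ :=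
  Q.fin.trAt v νG f

/-! ## §3 Read-backs -/

/-- Unfolding of `n`. [cite: Rogawski1990, §13.3 Thm. 13.3.7 pp. 202–203] -/
theorem n_eq (Q : SpectralPacketG 𝔩 𝔞 μ) (DiscH : GlobalPacketH 𝔩 → Prop) : Q.n DiscH = ((Q.fin.nRecip DiscH : ℚ) : ℂ) :=
  rfl

/-- Unfolding of `trS`: archimedean factor times the product of the `S`-factors. [cite: Rogawski1990, §13.3 p. 203; §14.2 p. 233] -/
theorem trS_eq (Q : SpectralPacketG 𝔩 𝔞 μ) {ι : L →+* ℂ} {T : GL (Fin 3) ℂ}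
    {hT : (T : Matrix (Fin 3) (Fin 3) ℂ)ᴴ * H.map ι * (T : Matrix (Fin 3) (Fin 3) ℂ) = Literature.Geometry.ComplexHyperbolic.BallModel.J}
    (S : Finset (HeightOneSpectrum (𝓞 ↥(maximalRealSubfield L))))
    [∀ v : HeightOneSpectrum (𝓞 ↥(maximalRealSubfield L)), MeasurableSpace ((cmDatum L 3 H).Local v)]
    (νG : ∀ v : HeightOneSpectrum (𝓞 ↥(maximalRealSubfield L)), Measure ((cmDatum L 3 H).Local v))
    (archTr : GKIrrClass (uFormGroup (Fin 2) (Fin 1)) → (UnitaryGroup.arch (↥(maximalRealSubfield L)) L (IsCMField.complexConj L) 3 H → ℂ) → ℂ)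
    (fS : TestS₀ L H ι T hT S) :
    Q.trS S νG archTr fS = 𝔞.trPktInf archTr Q.inf fS.arch * ∏ v : ↥S, (𝔩 v.1).trPkt (νG v.1) (Q.fin.loc v.1) (fS.loc v) :=
  rfl

/-- The discrete witness of a spectral packet: some member family occurs in the discrete spectrum. [cite: Rogawski1990, §13.3 p. 203 ¶2] -/
theorem exists_mem_occurs (Q : SpectralPacketG 𝔩 𝔞 μ) :
    ∃ π : ∀ v : HeightOneSpectrum (𝓞 ↥(maximalRealSubfield L)), IrrClass ((cmDatum L 3 H).Local v),
      Q.fin.Mem π ∧ F0P3GlobalPacketDiscrete.cmOccursInDiscreteSpectrum L 3 H μ π :=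
  Q.isDiscrete

/-- `trAt` is the finite-place kit's packet trace at `Q.fin.loc v`. [cite: Rogawski1990, §13.3 p. 203] -/
theorem trAt_eq (Q : SpectralPacketG 𝔩 𝔞 μ) (v : HeightOneSpectrum (𝓞 ↥(maximalRealSubfield L)))
    [MeasurableSpace ((cmDatum L 3 H).Local v)] (νG : Measure ((cmDatum L 3 H).Local v)) (f : (cmDatum L 3 H).Local v → ℂ) :
    Q.trAt v νG f = (𝔩 v).trPkt νG (Q.fin.loc v) f :=
  rfl

end SpectralPacketG

end Summit.HodgeConjecture.HodgeConjecture.Cruxes.H413.F0P3SpectralPacket
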